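import Summits.NavierStokesRegularity.NavierStokesRegularity.Theses.RellichScar
import Summits.NavierStokesRegularity.NavierStokesRegularity.Theorems.SymmetricScarExists.Negative.SpiralWorld
import Summits.NavierStokesRegularity.NavierStokesRegularity.Theorems.SymmetricScarExists.Negative.RdssWall
import Summits.NavierStokesRegularity.NavierStokesRegularity.Theorems.TypeIDSSLiouvilleConjecture
import Summits.NavierStokesRegularity.NavierStokesRegularity.Theorems.RellichScarSymmetricScarExistsDssNearOne
import Literature.Analysis.FluidPDE.TypeIAncientMild
import Literature.Analysis.FluidPDE.SelfSimilarLiouville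

/-!
# Crux `SymmetricScarExists` (stmt-NavierStokesRegularity-11718), line `rdss-screw-split`: the WALL BRIDGE
# for child C (`RdssApexFatal`)

Helper file of the line lead (`--supports stmt-NavierStokesRegularity-11718`; theorems only, no definitions, no
named-fact hypotheses other than the tree's OPEN conjecture `RotatedTypeIDSSLiouville` /
`Summit.NavierStokesRegularity.NavierStokesRegularity.TypeIDSSLiouvilleConjecture`, taken as an explicit
hypothesis).  Child C of the screw split of the crux (`Theorems/RellichScarSymmetricScarExistsSplit.lean`,
glue `symmetricScarExists_of_rdssSplit : A → B → C → S`) is the Type-I rotated-discretely-self-similar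
Liouville problem about the `x₃`-axis in APEX-CLASS form: no suitable weak solution on the backward slab with
a weak gradient, `𝐈 < ∞` and the apex bound `‖u‖ ≤ C/(‖x‖ + √(−t))`, singular at the origin, is a.e. fixed
by a screw-dilation `u ↦ R_θ D_c u ∘ R_{−θ}` with `c > 1`.  This is the field's named wall (Bradshaw–Tsai
2017 OP 5.1, Tsai GSM 192 Conj. 8.8–8.9, Pineau–Vicol 2026 Conj. 1.1).  This file pins it to the tree's
canonical statement of that wall:

* `rdssApexFatal_of_rotatedTypeIDSSLiouville` (registered auxiliary stub, factor-wise bridge): for fixed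
  `(c, θ)`, the tree's `RotatedTypeIDSSLiouville c (rotZIso (−θ))` (every ancient mild solution with
  measurable slices which is rotated `c`-DSS for the isometry `R_{−θ}` and has a Type-I bound vanishes
  slice-wise) implies child C at `(c, θ)`.  Proof (the template of `dssApexFatal_nearOne`): a nonpositive
  constant kills the profile outright; otherwise the profile is a.e. a Type-I ancient mild field `V`
  (`stub_apexMildRepresentative`, KNSS Lemma 3.1 + Prop. 4.1); the a.e. screw identity transports to `V`
  (`conjZ_ae_eq_slab ∘ nsRescale_ae_eq_slab`) and holds pointwise on the open slab by continuity
  (`Measure.eqOn_open_of_ae_eq`); the truncation `V' = 𝟙_{t<0} V` is again Type-I ancient mild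
  (`isTypeIAncientMild_truncate`), everywhere rotated DSS (`isRotatedDSS_truncate`), with the Type-I bound;
  the wall makes its slices a.e. zero, hence (continuity) `V ≡ 0` on `t < 0`, so `u = 0` a.e. on the slab
  and the origin is not singular (`not_isBackwardSingularPoint_of_ae_zero_slab`).
* `rdssApexFatal_of_typeIDSSLiouvilleConjecture` (registered auxiliary stub, canonical bridge):
  `TypeIDSSLiouvilleConjecture → C` verbatim — the theorem that makes the route item C closable by anyone
  proving the canonical conjecture shared by the other routes.

References: Z. Bradshaw, T.-P. Tsai, Comm. PDE 42 (2017) = arXiv:1610.05680, §5 OP 5.1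
[BradshawTsai2017CPDE]; T.-P. Tsai, GSM 192 (2018), Conj. 8.8–8.9 [Tsai2018]; B. Pineau, V. Vicol,
arXiv:2607.09619, Conj. 1.1 [PineauVicol2026]; D. Chae, J. Wolf, arXiv:1610.09464, Def. 1.1
[ChaeWolf2017RemovingDSS]; G. Koch, N. Nadirashvili, G. Seregin, V. Šverák, Acta Math. 203 (2009),
Lemma 3.1, Prop. 4.1, §4 p. 8 [KNSS2009].
-/

noncomputable section

open MeasureTheory Set Function Filter Topology TopologicalSpace Metric
open scoped NNReal ENNReal

namespace Summit.NavierStokesRegularity.NavierStokesRegularity.Theorems.SymmetricScarExists.RdssSplit.WallBridge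

open Literature.Analysis.FluidPDE
open Summit.NavierStokesRegularity.NavierStokesRegularity.Theses.RellichScar
open Summit.NavierStokesRegularity.NavierStokesRegularity.Theorems.SymmetricScarExists.Negative
open Summit.NavierStokesRegularity.NavierStokesRegularity.Theorems.SymmetricScarExists.ScarWindow
open Summit.NavierStokesRegularity.NavierStokesRegularity.Theorems.RellichScarScarRigidity
  (stub_apexMildRepresentative)

set_option linter.dupNamespace false

/-! ## §1 Truncation to the past -/

/-- **Truncation to the past keeps a Type-I ancient mild field Type-I ancient mild**: all four clauses of
`IsTypeIAncientMild` (smoothness on the open slab, divergence-free slices, the Oseen–Duhamel identity between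
`s < t < 0` — whose time integral runs over `(s, t) ⊆ (−∞, 0)` —, the Type-I rate) only read the field at
negative times. [folklore] -/
theorem isTypeIAncientMild_truncate {C : ℝ} {V : ℝ → EuclideanSpace ℝ (Fin 3) → EuclideanSpace ℝ (Fin 3)}
    (h : IsTypeIAncientMild C V) :
    IsTypeIAncientMild C (fun t x => if t < 0 then V t x else 0) := by
  have hslice : ∀ t : ℝ, t < 0 → (fun x => if t < 0 then V t x else (0 : EuclideanSpace ℝ (Fin 3))) = V t :=
    fun t ht => funext fun x => if_pos ht
  refine ⟨?_, fun t ht => ?_, fun s t hst ht x => ?_, fun t ht x => ?_⟩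
  · refine h.contDiffOn.congr ?_
    rintro ⟨t, x⟩ ⟨ht, -⟩
    simp only [uncurry_apply_pair, if_pos (show t < 0 from ht)]
  · dsimp only
    rw [hslice t ht]
    exact h.isDivFree ht
  · have hs : s < 0 := hst.trans ht
    dsimp only
    rw [if_pos ht, hslice s hs, h.mild_eq hst ht x, oseenDuhamel_apply, oseenDuhamel_apply]
    congr 1
    refine setIntegral_congr_fun measurableSet_Ioo fun τ hτ => ?_
    simp only [if_pos (hτ.2.trans ht)]
  · dsimp only
    rw [if_pos ht]
    exact h.norm_le ht x

/-- Truncation to the past keeps the apex (space–time Type-I) bound, which only reads `t < 0`. [folklore] -/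
theorem hasTypeIDecay_truncate {C : ℝ} {V : ℝ → EuclideanSpace ℝ (Fin 3) → EuclideanSpace ℝ (Fin 3)}
    (h : HasTypeIDecay C V) : HasTypeIDecay C (fun t x => if t < 0 then V t x else 0) := fun t ht x => by
  dsimp only
  rw [if_pos ht]
  exact h t ht x

/-- **An on-the-slab screw-invariant field truncates to an everywhere rotated-DSS field.**  If
`R_θ (c V(c²t, c R_{−θ} x)) = V(t, x)` for all `t < 0` and `x` (`c > 0`), then `𝟙_{t<0} V` is
`IsRotatedDSS c (rotZIso (−θ))` in the tree's all-time sense (Chae–Wolf 2017, Def. 1.1): for `t ≥ 0` both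
sides vanish. [cite: ChaeWolf2017RemovingDSS, Definition 1.1 (arXiv:1610.09464 p. 2)] -/
theorem isRotatedDSS_truncate {c θ : ℝ} {V : ℝ → EuclideanSpace ℝ (Fin 3) → EuclideanSpace ℝ (Fin 3)}
    (hc : 0 < c) (h : ∀ t : ℝ, t < 0 → ∀ x : EuclideanSpace ℝ (Fin 3), conjZ θ (nsRescale c V) t x = V t x) :
    IsRotatedDSS c (rotZIso (-θ)) (fun t x => if t < 0 then V t x else 0) := by
  intro t x
  simp only [rotZIso_apply, rotZIso_symm_apply, neg_neg]
  by_cases ht : t < 0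
  · have hct : c ^ 2 * t < 0 := mul_neg_of_pos_of_neg (by positivity) ht
    have key := h t ht x
    simp only [conjZ, nsRescale_apply, rotZ_smul'] at key
    rw [if_pos hct, if_pos ht]
    exact key
  · have hct : ¬ c ^ 2 * t < 0 := not_lt.2 (mul_nonneg (sq_nonneg c) (not_lt.1 ht))
    have h0 : rotZ θ (0 : EuclideanSpace ℝ (Fin 3)) = 0 := (rotZIso θ).map_zero
    rw [if_neg hct, if_neg ht, h0, smul_zero]

/-! ## §2 The wall bridge -/

/-- **Factor-wise wall bridge** (registered auxiliary stub `rdssApexFatal_of_rotatedTypeIDSSLiouville` of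
crux stmt-NavierStokesRegularity-11718, line rdss-screw-split): the tree's rotated Type-I `c`-DSS Liouville
statement for the isometry `R_{−θ}` (Bradshaw–Tsai 2017 OP 5.1 in the form `RotatedTypeIDSSLiouville`)
implies child C of the screw split at `(c, θ)` — no singular apex Type-I profile is a.e. fixed on the slab by
the screw-dilation `u ↦ R_θ D_c u ∘ R_{−θ}`. [cite: BradshawTsai2017CPDE, §5 Open Problem 5.1 (arXiv:1610.05680)] -/
theorem rdssApexFatal_of_rotatedTypeIDSSLiouville :
    ∀ (c θ : ℝ), RotatedTypeIDSSLiouville c (rotZIso (-θ)) → ∀ (u : ℝ → EuclideanSpace ℝ (Fin 3) → EuclideanSpace ℝ (Fin 3)) (p : ℝ → EuclideanSpace ℝ (Fin 3) → ℝ) (G : ℝ → EuclideanSpace ℝ (Fin 3) → EuclideanSpace ℝ (Fin 3) →L[ℝ] EuclideanSpace ℝ (Fin 3)) (C : ℝ), IsSuitableWeakSolutionOn (slab (EuclideanSpace ℝ (Fin 3)) (Iio 0) isOpen_Iio) 1 0 u p → HasWeakSpatialGradientOn (slab (EuclideanSpace ℝ (Fin 3)) (Iio 0) isOpen_Iio)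 u G → typeIBound (Iio (0 : ℝ) ×ˢ univ) u p G < ⊤ → HasTypeIDecay C u → IsBackwardSingularPoint u 0 → 1 < c → uncurry (fun t x => rotZ θ (nsRescale c u t (rotZ (-θ) x))) =ᵐ[volume.restrict (Iio (0 : ℝ) ×ˢ univ)] uncurry u → False := by
  intro c θ hwall u p G C hsw hwg hI hdec hsing hc hrdss
  have hc0 : 0 < c := one_pos.trans hc
  rcases le_or_gt C 0 with hC0 | hC
  · -- a nonpositive constant: the field vanishes on the slab
    refine not_isBackwardSingularPoint_of_ae_zero_slab (u := u) ?_ hsing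
    filter_upwards [ae_restrict_mem (measurableSet_Iio.prod MeasurableSet.univ)] with w hw
    exact eq_zero_of_hasTypeIDecay_nonpos hC0 hdec hw.1 w.2
  -- the Type-I ancient mild representative
  obtain ⟨V, hae, hmild, hdecV⟩ := stub_apexMildRepresentative u p G C hC hsw hwg hI hdec
  have hcontV : ContinuousOn (uncurry V) (Iio (0 : ℝ) ×ˢ (univ : Set (EuclideanSpace ℝ (Fin 3)))) :=
    hmild.continuousOn_uncurry
  -- the a.e. screw identity transports to `V` and holds pointwise on the open slab
  have hrdss' : uncurry (conjZ θ (nsRescale c u))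
      =ᵐ[volume.restrict (Iio (0 : ℝ) ×ˢ (univ : Set (EuclideanSpace ℝ (Fin 3))))] uncurry u := hrdss
  have haeV : uncurry (conjZ θ (nsRescale c V))
      =ᵐ[volume.restrict (Iio (0 : ℝ) ×ˢ (univ : Set (EuclideanSpace ℝ (Fin 3))))] uncurry V :=
    ((conjZ_ae_eq_slab θ (nsRescale_ae_eq_slab hc0 hae)).trans hrdss').trans hae.symm
  have heqOn : EqOn (uncurry (conjZ θ (nsRescale c V))) (uncurry V)
      (Iio (0 : ℝ) ×ˢ (univ : Set (EuclideanSpace ℝ (Fin 3)))) :=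
    Measure.eqOn_open_of_ae_eq haeV (isOpen_Iio.prod isOpen_univ)
      (continuousOn_uncurry_conjZ θ (continuousOn_uncurry_nsRescale hc0 hcontV)) hcontV
  have hVrdss : ∀ t : ℝ, t < 0 → ∀ x : EuclideanSpace ℝ (Fin 3), conjZ θ (nsRescale c V) t x = V t x :=
    fun t ht x => heqOn (mk_mem_prod ht (mem_univ x))
  -- truncate to the past and apply the wall
  have hmild' := isTypeIAncientMild_truncate hmild
  have hzero : ∀ t < (0 : ℝ),
      (fun t x => if t < 0 then V t x else (0 : EuclideanSpace ℝ (Fin 3))) t =ᵐ[volume] 0 :=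
    hwall hc _ hmild'.isAncientMildSolution (fun t ht => hmild'.aestronglyMeasurable_slice ht)
      (isRotatedDSS_truncate hc0 hVrdss) ⟨C, hasTypeIDecay_truncate hdecV⟩
  have hV0 : ∀ t : ℝ, t < 0 → ∀ x : EuclideanSpace ℝ (Fin 3), V t x = 0 := by
    intro t ht x
    have h1 : V t =ᵐ[volume] (0 : EuclideanSpace ℝ (Fin 3) → EuclideanSpace ℝ (Fin 3)) := by
      have h2 := hzero t ht
      simp only [if_pos ht] at h2
      exact h2
    have h3 : V t = 0 := Measure.eq_of_ae_eq h1 (hmild.continuous_slice ht) continuous_const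
    rw [h3, Pi.zero_apply]
  -- hence `u = 0` a.e. on the slab, and the origin is not singular
  refine not_isBackwardSingularPoint_of_ae_zero_slab (u := u) ?_ hsing
  filter_upwards [hae, ae_restrict_mem (measurableSet_Iio.prod MeasurableSet.univ)] with w hw hmem
  rw [← hw]
  exact hV0 w.1 hmem.1 w.2

/-- **Canonical wall bridge** (registered auxiliary stub `rdssApexFatal_of_typeIDSSLiouvilleConjecture` of crux
stmt-NavierStokesRegularity-11718, line rdss-screw-split): the tree's canonical Type-I DSS Liouville conjecture
(`Summit.NavierStokesRegularity.NavierStokesRegularity.TypeIDSSLiouvilleConjecture`; Bradshaw–Tsai 2017 OP 5.1,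
Tsai GSM 192 Conj. 8.8–8.9) implies child C (`RdssApexFatal`) of the screw split verbatim: specialise its
rotated half to the factor `c` and the isometry `R_{−θ}`. [cite: BradshawTsai2017CPDE, §5 Open Problem 5.1 (arXiv:1610.05680)] -/
theorem rdssApexFatal_of_typeIDSSLiouvilleConjecture :
    Summit.NavierStokesRegularity.NavierStokesRegularity.TypeIDSSLiouvilleConjecture → ∀ (u : ℝ → EuclideanSpace ℝ (Fin 3) → EuclideanSpace ℝ (Fin 3)) (p : ℝ → EuclideanSpace ℝ (Fin 3) → ℝ) (G : ℝ → EuclideanSpace ℝ (Fin 3) → EuclideanSpace ℝ (Fin 3) →L[ℝ] EuclideanSpace ℝ (Fin 3)) (C c θ : ℝ), IsSuitableWeakSolutionOn (slab (EuclideanSpace ℝ (Fin 3)) (Iio 0) isOpen_Iio) 1 0 u p → HasWeakSpatialGradientOn (slab (EuclideanSpace ℝ (Fin 3)) (Iio 0) isOpen_Iio) u G → typeIBound (Iio (0 : ℝ) ×ˢ univ) u p G < ⊤ → HasTypeIDecay C u → IsBackwardSingularPoint u 0 → 1 < c → uncurry (fun t x => rotZ θ (nsRescale c u t (rotZ (-θ)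 x))) =ᵐ[volume.restrict (Iio (0 : ℝ) ×ˢ univ)] uncurry u → False :=
  fun hW u p G C c θ hsw hwg hI hdec hsing hc hrdss =>
    rdssApexFatal_of_rotatedTypeIDSSLiouville c θ ((hW c).2 (rotZIso (-θ))) u p G C hsw hwg hI hdec hsing
      hc hrdss

end Summit.NavierStokesRegularity.NavierStokesRegularity.Theorems.SymmetricScarExists.RdssSplit.WallBridge

end
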